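import Summits.HodgeConjecture.HodgeConjecture.Theorems.A3Liu413TowerAdmissible
import Summits.HodgeConjecture.HodgeCM.PerL34.LevelLattice_2
import Literature.GroupTheory.Lattices.CommensuratorIndexUnimodular
import HarnessLib

/-!
# `h413` stub (b), level-form assembly (b6) — the arithmetic input (III) and the level family, in the currency of the tower

Support file for the crux `H413` (stmt-HodgeConjecture-24833), line `a3-liu413`, stub `stub_unitarizableAtPin` (A-p10 SPEC-b6).  KERNEL ONLY
(theorems; no definition, no named fact).  For the class weights of `Literature.GroupTheory.ClassSetMass` instantiated at
`G := U(V)(𝔸_{L₀,f}) = V.adelicFin`, `U := U(V)(L₀) = (ρ V).range`, `K₀ := K_f(3)`, `𝒞 :=` the open compact subgroups, this file supplies: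

* §1 `relIndex_ne_zero_of_isCompact_isOpen`, `commensurable_of_isCompact_isOpen` — open compact subgroups are pairwise commensurable;
  `isCompact_isOpen_map_conj` — and stable under conjugation.
* §2 `ρ_injective`; `locallyCompactSpace_Uinf`, `secondCountableTopology_Uinf` — the two instances of `U(V)_∞` the lattice theorem wants.
* §3 **`relIndex_map_conj_range_inf_eq`** — the input (III) of the weight calculus: for a level `Δ₀` and a RATIONAL `u = (γ)_f`,
  `[Λ : Λ ∩ uΛu⁻¹] = [uΛu⁻¹ : Λ ∩ uΛu⁻¹]` for `Λ := U(V)(L₀) ∩ K_{Δ₀}` read inside `U(V)(𝔸_f)` — transported along the two injections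
  `U(V)(L₀) → U(V)(𝔸_f)` and `U(V)(L₀) → U(V)_∞` (`Subgroup.relIndex_map_map_of_injective`) from
  `Literature.GroupTheory.CocompactLattice.relIndex_map_conj_eq` (row III-12, [ShimuraIATAF1971, Prop. 3.6]) at the uniform lattice
  `archLattice L V.Hm Δ₀.Γ ≤ U(V)_∞` (`Level.discreteTopology_archLattice`, `Level.compactSpace_quotient_archLattice`, `[L:ℚ] ≠ 2`).
HC_CM is proved only modulo the printed citations until rung 0 closes; this file discharges nothing of them.
-/

noncomputable section

open scoped Pointwise
open NumberField IsDedekindDomain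
open Literature.AlgebraicGeometry.ShimuraVarieties
open Literature.NumberTheory.Automorphic
open HodgeCM.Adelic HodgeCM.PerL34.AdelicUnitaryFactorisation HodgeCM.PerL34.Godement

namespace HodgeCM

open HodgeCM.Model.LevelTranslate

/-! ## §1 Open compact subgroups: commensurable, conjugation-stable -/

section OpenCompact

variable {G : Type*} [Group G] [TopologicalSpace G] [IsTopologicalGroup G]

/-- An open subgroup has finite index in a compact one: `[K : N ∩ K] ≠ 0` (compact and discrete coset space). [folklore] -/
theorem relIndex_ne_zero_of_isCompact_isOpen {K N : Subgroup G} (hKc : IsCompact (K : Set G)) (hNo : IsOpen (N : Set G)) :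
    N.relIndex K ≠ 0 := by
  haveI : CompactSpace K := isCompact_iff_compactSpace.mp hKc
  haveI : DiscreteTopology (K ⧸ N.subgroupOf K) :=
    QuotientGroup.discreteTopology (hNo.preimage continuous_subtype_val)
  haveI : Finite (K ⧸ N.subgroupOf K) := finite_of_compact_of_discrete
  exact Subgroup.index_ne_zero_of_finite

/-- Open compact subgroups are commensurable. [folklore] -/
theorem commensurable_of_isCompact_isOpen {K K' : Subgroup G} (hKc : IsCompact (K : Set G)) (hKo : IsOpen (K : Set G))
    (hK'c : IsCompact (K' : Set G)) (hK'o : IsOpen (K' : Set G)) : Subgroup.Commensurable K K' :=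
  ⟨relIndex_ne_zero_of_isCompact_isOpen hK'c hKo, relIndex_ne_zero_of_isCompact_isOpen hKc hK'o⟩

/-- A conjugate of an open compact subgroup is open compact. [folklore] -/
theorem isCompact_isOpen_map_conj {K : Subgroup G} (hK : IsCompact (K : Set G) ∧ IsOpen (K : Set G)) (g : G) :
    IsCompact ((K.map (MulAut.conj g).toMonoidHom : Subgroup G) : Set G) ∧
      IsOpen ((K.map (MulAut.conj g).toMonoidHom : Subgroup G) : Set G) := by
  have hset : ((K.map (MulAut.conj g).toMonoidHom : Subgroup G) : Set G) = (Homeomorph.mulLeft g).trans (Homeomorph.mulRight g⁻¹) '' (K : Set G) := by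
    ext x
    simp only [Subgroup.coe_map, MulEquiv.coe_toMonoidHom, Set.mem_image, SetLike.mem_coe, MulAut.conj_apply,
      Homeomorph.trans_apply, Homeomorph.coe_mulLeft, Homeomorph.coe_mulRight]
  rw [hset]
  exact ⟨hK.1.image (Homeomorph.continuous _), (Homeomorph.isOpenMap _) _ hK.2⟩

end OpenCompact

/-! ## §2 The rational points inside `U(V)(𝔸_f)` and inside `U(V)_∞` -/

namespace Model.TowerLevel

variable {L : CMField} {ι₁ : L →+* ℂ} (V : HermSpace3 L ι₁)

/-- `L → 𝔸_{L,f}` is injective (evaluate at one finite place). [folklore] -/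
private theorem algebraMap_finiteAdeleRing_injective :
    Function.Injective (algebraMap (L : Type) (FiniteAdeleRing (𝓞 L) L)) := by
  obtain ⟨M, hM⟩ := Ideal.exists_maximal (𝓞 L)
  let v : HeightOneSpectrum (𝓞 L) :=
    ⟨M, hM.isPrime, Ring.ne_bot_of_isMaximal_of_not_isField hM (RingOfIntegers.not_isField L)⟩
  intro a a' h
  have h' := congrArg (fun z : FiniteAdeleRing (𝓞 L) L => z v) h
  simp only [FiniteAdeleRing.algebraMap_apply] at h'
  exact (algebraMap (L : Type) (v.adicCompletion L)).injective h'

/-- **`ρ = (·)_f : U(V)(L₀) → U(V)(𝔸_{L₀,f})` is injective.** [folklore] -/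
theorem ρ_injective : Function.Injective (ρ V) := by
  intro g h hgh
  have e : ((g : GL (Fin 3) L) : Matrix (Fin 3) (Fin 3) L).map (algebraMap (L : Type) (FiniteAdeleRing (𝓞 L) L)) =
      ((h : GL (Fin 3) L) : Matrix (Fin 3) (Fin 3) L).map (algebraMap (L : Type) (FiniteAdeleRing (𝓞 L) L)) :=
    congrArg
      (fun x : V.adelicFin => ((x : GL (Fin 3) (FiniteAdeleRing (𝓞 L) L)) : Matrix (Fin 3) (Fin 3) (FiniteAdeleRing (𝓞 L) L))) hgh
  apply Subtype.ext
  apply Units.ext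
  exact (Matrix.map_injective (algebraMap_finiteAdeleRing_injective (L := L))) e

/-- `U(V)_∞ = Uinf L V.Hm` is locally compact (closed in `GL₃(L_∞)`). [folklore] -/
theorem locallyCompactSpace_Uinf : LocallyCompactSpace (Uinf (L : Type) V.Hm) := by
  haveI : LocallyCompactSpace (Matrix (Fin 3) (Fin 3) (InfiniteAdeleRing L)) :=
    inferInstanceAs (LocallyCompactSpace (Fin 3 → Fin 3 → InfiniteAdeleRing L))
  exact (HodgeCM.PerL34.Godement.isClosed_unitaryGroup (continuous_infConj L) _).locallyCompactSpace

/-- `U(V)_∞` is second countable. [folklore] -/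
theorem secondCountableTopology_Uinf : SecondCountableTopology (Uinf (L : Type) V.Hm) := by
  haveI : SecondCountableTopology (Matrix (Fin 3) (Fin 3) (InfiniteAdeleRing L)) :=
    inferInstanceAs (SecondCountableTopology (Fin 3 → Fin 3 → InfiniteAdeleRing L))
  haveI : SecondCountableTopology (GL (Fin 3) (InfiniteAdeleRing L)) := inferInstance
  exact TopologicalSpace.Subtype.secondCountableTopology _

/-- `U(V)(L₀) ≤ U(H)(L)` in the two spellings of the conjugation (`IsCMField.complexConj` vs `conjRingHomK`). [folklore] -/
theorem Urat_le_unitaryGroup : Urat V ≤ unitaryGroup (conjRingHomK L) V.Hm := by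
  intro g hg
  rw [mem_unitaryGroup_iff, ← coe_complexConj_eq_conjRingHomK' L]
  exact mem_unitaryGroupOfForm_iff.mp hg

/-! ## §3 The input (III): commensurator-unimodularity of the arithmetic group, read in `U(V)(𝔸_f)` -/

/-- **(III) in the tower's currency.**  For a level `Δ₀` and a rational element `u = (γ)_f ∈ U(V)(L₀)`, with
`Λ := (ρ V).range ⊓ K_{Δ₀}` (the image of `Δ₀.Γ = U(V)(L₀) ∩ K_{Δ₀}` in `U(V)(𝔸_f)`):
`[Λ : Λ ∩ uΛu⁻¹] = [uΛu⁻¹ : Λ ∩ uΛu⁻¹]`, i.e. `(uΛu⁻¹).relIndex Λ = Λ.relIndex (uΛu⁻¹)`.  Both indices are transported along the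
injections `ρ` and `γ ↦ γ_∞` to the uniform lattice `(Δ₀.Γ)_∞ ≤ U(V)_∞` (discrete, cocompact for `[L:ℚ] ≠ 2`), where this is the lattice
theorem `CocompactLattice.relIndex_map_conj_eq` ([ShimuraIATAF1971, §3.3 Prop. 3.6]: `μ(Γ\G)·[Γ : Γ ∩ gΓg⁻¹] = μ((Γ ∩ gΓg⁻¹)\G) =
μ(G/gΓg⁻¹)·[gΓg⁻¹ : Γ ∩ gΓg⁻¹]`). [cite: ShimuraIATAF1971, §3.3 Prop. 3.6] -/
theorem relIndex_map_conj_range_inf_eq (hL : Module.finrank ℚ L ≠ 2) (Δ₀ : Level V) {u : V.adelicFin} (hu : u ∈ (ρ V).range) :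
    (((ρ V).range ⊓ Δ₀.K).map (MulAut.conj u).toMonoidHom).relIndex ((ρ V).range ⊓ Δ₀.K) =
      ((ρ V).range ⊓ Δ₀.K).relIndex (((ρ V).range ⊓ Δ₀.K).map (MulAut.conj u).toMonoidHom) := by
  obtain ⟨γ, rfl⟩ := hu
  -- (1) pull back to `U(V)(L₀)`: `Λ = ρ(A)`, `A := ρ⁻¹ K_{Δ₀}`
  set A : Subgroup (Urat V) := Δ₀.K.comap (ρ V) with hA
  have hUA : (ρ V).range ⊓ Δ₀.K = A.map (ρ V) := by rw [Subgroup.map_comap_eq]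
  have hconjρ : (A.map (ρ V)).map (MulAut.conj (ρ V γ)).toMonoidHom = (A.map (MulAut.conj γ).toMonoidHom).map (ρ V) := by
    rw [Subgroup.map_map, Subgroup.map_map]
    congr 1
    ext x
    simp [MulAut.conj_apply]
  rw [hUA, hconjρ, Subgroup.relIndex_map_map_of_injective _ _ (ρ_injective V),
    Subgroup.relIndex_map_map_of_injective _ _ (ρ_injective V)]
  -- (2) push forward to `U(V)_∞` along `σ : γ ↦ γ_∞`
  let σ : ↥(Urat V) →* ↥(Uinf (L : Type) V.Hm) :=
    ((toInfGL L).comp (Urat V).subtype).codRestrict (Uinf (L : Type) V.Hm)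
      (fun g => toInfGL_mem_Uinf L (Urat_le_unitaryGroup V g.2))
  have hσinj : Function.Injective σ := by
    intro a b h
    have h' := congrArg (fun x : Uinf (L : Type) V.Hm => (x : GL (Fin 3) (InfiniteAdeleRing L))) h
    exact Subtype.ext (toInfGL_injective L h')
  have hσA : A.map σ = archLattice L V.Hm Δ₀.Γ := by
    ext a
    rw [mem_archLattice_iff, Subgroup.mem_map]
    constructor
    · rintro ⟨x, hx, rfl⟩
      exact ⟨(x : GL (Fin 3) L), (Level.mem_Γ_iff Δ₀).mpr ⟨x.2, Subgroup.mem_comap.mp hx⟩, rfl⟩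
    · rintro ⟨g, hg, hga⟩
      obtain ⟨hgU, hgK⟩ := (Level.mem_Γ_iff Δ₀).mp hg
      exact ⟨⟨g, hgU⟩, Subgroup.mem_comap.mpr hgK, Subtype.ext hga⟩
  have hconjσ : (A.map (MulAut.conj γ).toMonoidHom).map σ = (A.map σ).map (MulAut.conj (σ γ)).toMonoidHom := by
    rw [Subgroup.map_map, Subgroup.map_map]
    congr 1
    ext x
    simp [MulAut.conj_apply]
  rw [← Subgroup.relIndex_map_map_of_injective (A.map (MulAut.conj γ).toMonoidHom) A hσinj,
    ← Subgroup.relIndex_map_map_of_injective A (A.map (MulAut.conj γ).toMonoidHom) hσinj, hconjσ, hσA]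
  -- (3) the lattice theorem at the uniform lattice `(Δ₀.Γ)_∞ ≤ U(V)_∞`
  haveI := locallyCompactSpace_Uinf V
  haveI := secondCountableTopology_Uinf V
  haveI := Level.discreteTopology_archLattice L V Δ₀
  haveI := Level.compactSpace_quotient_archLattice L V Δ₀ hL
  exact Literature.GroupTheory.CocompactLattice.relIndex_map_conj_eq _ _

end Model.TowerLevel

end HodgeCM

end
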